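import Mathlib.Algebra.Order.Chebyshev
import Mathlib.Analysis.RCLike.Basic
import Literature.Computability.AlgebraicComplexity.PermanentIrreducible
import HarnessLib

/-!
# The permanent-correlation functional: squared cosine with `per_n` in coefficient space

Topic `Literature/Computability/AlgebraicComplexity`.  Vocabulary requested by route
`ValiantsHypothesis/OneNatPerBit` (card `correlation-law-nat-per-bit`), all of whose items inline the
three expressions `permMass`, `coeffNormSq`, `permCorrSq` below; placed next to `permMonomial`
(`PermanentIrreducible.lean`) and written in the tree's column-major convention
`permMonomial σ = ∑_i e_{(σ i, i)}` (the exponent vector of the monomial `∏_i X_{(σ i, i)}` of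
`perPoly (Fin n) R = per (X_{ij}) = ∑_σ ∏_i X_{(σ i, i)}`).

For `f : MvPolynomial (Fin n × Fin n) R`:

* `permMass n f = ∑_{σ ∈ S_n} coeff_{μ_σ} f` — the *permutation mass* of `f`: the (unnormalised)
  inner product, in coefficient space, of `f` with `per_n` (all of whose coefficients are `1`,
  `coeff_permMonomial_perPoly`).  It is `R`-linear and `permMass n per_n = n!` (`permMass_perPoly`).
* `coeffNormSq n f = ∑_{m ∈ supp f} ‖coeff_m f‖²` — the squared `ℓ²` norm of the coefficient vector
  of `f` (every monomial of `f` counts, also the "junk" monomials that are not permutation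
  monomials).
* `permCorrSq n f = ‖permMass n f‖² / (n! · coeffNormSq n f)` — the **squared cosine of the angle
  between `f` and `per_n`** in coefficient space (real division, so `permCorrSq n 0 = 0`).
  `0 ≤ permCorrSq n f ≤ 1` (`permCorrSq_le_one`, Cauchy–Schwarz over the `n!` permutation
  monomials), `permCorrSq n per_n = 1` (`permCorrSq_perPoly`), `permCorrSq n (c • f) = permCorrSq n f`
  for `c ≠ 0` (`permCorrSq_smul`), and `permCorrSq_le_iff` unfolds a bound `permCorrSq n f ≤ t` into
  the division-free form `‖permMass n f‖² ≤ t · (n! · coeffNormSq n f)` in which the route items are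
  written.

The test polynomials on which the functional is calibrated:

* `selfMapMonomial φ = ∑_i e_{(φ i, i)}` for a self-map `φ : Fin n → Fin n` (one variable from each
  column; `selfMapMonomial ⇑σ = permMonomial σ` holds by `rfl`), and the column-set-multilinear
  polynomial `columnMultilinear c = ∑_φ c(φ) · X^{selfMapMonomial φ}` with coefficient function `c`:
  `permMass = ∑_σ c σ`, `coeffNormSq = ∑_φ ‖c φ‖²`.
* products of linear forms, the `i`-th one in the variables of column `i`:
  `∏_i (∑_j a_{ij} X_{(j,i)}) = columnMultilinear (φ ↦ ∏_i a_{i,φ i})`, whence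
  `permMass = ∑_σ ∏_i a_{i,σ i}` (the permanent of the array `a`; Carlen–Lieb–Loss 2006, eq. (1.3))
  and `coeffNormSq = ∏_i ∑_j ‖a_{ij}‖²`.  Carlen–Lieb–Loss's inequality of Hadamard type for
  permanents ([CarlenLiebLoss2006], Thm. 1.1: `|perm F| ≤ N!/N^{N/2} · ∏_j |f_j|`, `f_j` the columns of
  `F`) says exactly `permCorrSq n (∏_i ∑_j a_{ij} X_{(j,i)}) ≤ n!/nⁿ`; it is NOT proved here.
* `rowABPCoeff n w A u v φ = uᵀ · A₀(φ 0) · A₁(φ 1) ⋯ A_{n-1}(φ (n-1)) · v`, the coefficient on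
  `∏_i X_{(φ i, i)}` of the layer-ordered set-multilinear algebraic branching program of width `w`
  with transition matrices `A i j` (an iterated matrix product, Nisan 1991), and its polynomial
  `rowABPPoly n w A u v = columnMultilinear (rowABPCoeff n w A u v)`; at width `1` these are the
  products of linear forms up to a scalar (`rowABPCoeff_width_one`).

Generality: `permMass`, `columnMultilinear`, `rowABPCoeff` make sense over any commutative
semiring `R` (`permMass_map` moves e.g. `ℝ≥0`-coefficients into `ℝ`); `coeffNormSq`/`permCorrSq` over
any normed commutative ring (the route uses `R = ℂ`); scale invariance needs a normed field and
`permCorrSq_perPoly` is stated for `RCLike 𝕜` (`ℝ` or `ℂ`, where `‖(n! : 𝕜)‖ = n!`).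

No name for the functional exists in the literature (searched 2026-08-15 by the requesting planner
and again for this file); the definitions are folklore normalisations recorded so that route items
can be stated over a named functional.  Deliberately not here: the Carlen–Lieb–Loss bound itself,
anything about circuits, and the determinant (`permMass n det_n = ∑_σ sgn σ = 0` for `n ≥ 2`).

## References

* [CarlenLiebLoss2006] E. Carlen, E. H. Lieb, M. Loss, *An inequality of Hadamard type for
  permanents*, Methods Appl. Anal. 13 (2006) 1–18 — Thm. 1.1 and eq. (1.3).
* [Nisan1991Noncommutative] N. Nisan, *Lower bounds for non-commutative computation*, STOC 1991 —
  algebraic branching programs as iterated matrix products.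
* [Vonzurgathen1987] J. von zur Gathen, *Permanent and determinant*, Linear Algebra Appl. 96
  (1987) — §2, permutation monomials (`permMonomial`, `PermanentIrreducible.lean`).
-/

noncomputable section

open MvPolynomial
open scoped Matrix

namespace Literature.Computability.AlgebraicComplexity

variable {n : ℕ}

/-! ### Monomials of self-maps and column-set-multilinear polynomials -/

section SelfMap

/-- The exponent vector `∑_i e_{(φ i, i)}` of the monomial `∏_i X_{(φ i, i)}` that takes from each
column `i` the variable in row `φ i` (`φ : Fin n → Fin n` an arbitrary self-map; for a permutation
this is literally `permMonomial`, see `selfMapMonomial_coe_perm`). [folklore] -/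
def selfMapMonomial (φ : Fin n → Fin n) : (Fin n × Fin n) →₀ ℕ :=
  ∑ i, Finsupp.single (φ i, i) 1

/-- For a permutation `σ`, `selfMapMonomial ⇑σ` is the permutation monomial `permMonomial σ`
(definitionally). [folklore] -/
@[simp]
theorem selfMapMonomial_coe_perm (σ : Equiv.Perm (Fin n)) :
    selfMapMonomial ⇑σ = permMonomial σ := rfl

/-- `selfMapMonomial φ (r, c) = [φ c = r]`. [folklore] -/
theorem selfMapMonomial_apply (φ : Fin n → Fin n) (r c : Fin n) :
    selfMapMonomial φ (r, c) = if φ c = r then 1 else 0 := by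
  simp only [selfMapMonomial, Finsupp.coe_finsetSum, Finset.sum_apply, Finsupp.single_apply,
    Prod.mk.injEq]
  rw [Finset.sum_eq_single c]
  · simp
  · intro i _ hic
    simp [hic]
  · simp

/-- `φ ↦ selfMapMonomial φ` is injective (column `c` carries the single variable `(φ c, c)`).
[folklore] -/
theorem selfMapMonomial_injective : Function.Injective (selfMapMonomial (n := n)) := by
  intro φ ψ h
  funext c
  have := DFunLike.congr_fun h (φ c, c)
  rw [selfMapMonomial_apply, selfMapMonomial_apply, if_pos rfl] at this
  by_contra hne
  rw [if_neg (Ne.symm hne)] at this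
  exact one_ne_zero this

variable {R : Type*} [CommSemiring R]

/-- The column-set-multilinear polynomial `∑_φ c(φ) · ∏_i X_{(φ i, i)}` with coefficient function
`c` on the self-maps `φ : Fin n → Fin n` (every monomial takes exactly one variable from each
column). [folklore] -/
def columnMultilinear (c : (Fin n → Fin n) → R) : MvPolynomial (Fin n × Fin n) R :=
  ∑ φ : Fin n → Fin n, monomial (selfMapMonomial φ) (c φ)

/-- The coefficient of `∏_i X_{(φ i, i)}` in `columnMultilinear c` is `c φ`. [folklore] -/
@[simp]
theorem coeff_selfMapMonomial_columnMultilinear (c : (Fin n → Fin n) → R) (φ : Fin n → Fin n) :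
    coeff (selfMapMonomial φ) (columnMultilinear c) = c φ := by
  simp [columnMultilinear, coeff_sum, coeff_monomial, selfMapMonomial_injective.eq_iff]

/-- The coefficient of the permutation monomial `μ_σ` in `columnMultilinear c` is `c σ`. [folklore] -/
@[simp]
theorem coeff_permMonomial_columnMultilinear (c : (Fin n → Fin n) → R) (σ : Equiv.Perm (Fin n)) :
    coeff (permMonomial σ) (columnMultilinear c) = c σ :=
  coeff_selfMapMonomial_columnMultilinear c σ

/-- Monomials not of the form `∏_i X_{(φ i, i)}` do not occur in `columnMultilinear c`. [folklore] -/
theorem coeff_columnMultilinear_of_not_mem_range (c : (Fin n → Fin n) → R)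
    {m : (Fin n × Fin n) →₀ ℕ} (hm : m ∉ Set.range (selfMapMonomial (n := n))) :
    coeff m (columnMultilinear c) = 0 := by
  simp only [columnMultilinear, coeff_sum, coeff_monomial]
  exact Finset.sum_eq_zero fun φ _ => if_neg fun h => hm ⟨φ, h⟩

/-- The support of `columnMultilinear c` consists of self-map monomials. [folklore] -/
theorem support_columnMultilinear_subset (c : (Fin n → Fin n) → R) :
    (columnMultilinear c).support ⊆ (Finset.univ : Finset (Fin n → Fin n)).image selfMapMonomial := by
  intro m hm
  by_contra h
  refine (mem_support_iff.1 hm) (coeff_columnMultilinear_of_not_mem_range c ?_)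
  rintro ⟨φ, rfl⟩
  exact h (Finset.mem_image_of_mem _ (Finset.mem_univ φ))

/-- `columnMultilinear c` determines its coefficient function `c`. [folklore] -/
theorem columnMultilinear_injective :
    Function.Injective (columnMultilinear (n := n) (R := R)) := by
  intro c c' h
  funext φ
  rw [← coeff_selfMapMonomial_columnMultilinear c φ, h, coeff_selfMapMonomial_columnMultilinear]

/-- A product of linear forms, the `i`-th one in the variables `X_{(j,i)}` of column `i`, expands over
self-maps: `∏_i (∑_j a_{ij} X_{(j,i)}) = ∑_φ (∏_i a_{i,φ i}) · ∏_i X_{(φ i, i)}`. [folklore] -/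
theorem prod_linearForm_eq_columnMultilinear (a : Fin n → Fin n → R) :
    (∏ i : Fin n, ∑ j : Fin n, C (a i j) * X (j, i) : MvPolynomial (Fin n × Fin n) R) =
      columnMultilinear (fun φ => ∏ i, a i (φ i)) := by
  rw [Fintype.prod_sum]
  unfold columnMultilinear
  refine Finset.sum_congr rfl fun φ _ => ?_
  rw [Finset.prod_mul_distrib, ← map_prod C,
    show (∏ i, X (φ i, i) : MvPolynomial (Fin n × Fin n) R) = monomial (selfMapMonomial φ) 1 by
      rw [selfMapMonomial, monomial_sum_one]; rfl,
    C_mul_monomial, mul_one]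

/-- The coefficient of `∏_i X_{(φ i, i)}` in `∏_i (∑_j a_{ij} X_{(j,i)})` is `∏_i a_{i,φ i}`.
[folklore] -/
theorem coeff_selfMapMonomial_prod_linearForm (a : Fin n → Fin n → R) (φ : Fin n → Fin n) :
    coeff (selfMapMonomial φ)
        (∏ i : Fin n, ∑ j : Fin n, C (a i j) * X (j, i) : MvPolynomial (Fin n × Fin n) R) =
      ∏ i, a i (φ i) := by
  rw [prod_linearForm_eq_columnMultilinear, coeff_selfMapMonomial_columnMultilinear]

end SelfMap

/-! ### The permutation mass `⟨f, per_n⟩` -/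

section PermMass

variable {R : Type*} [CommSemiring R]

/-- The **permutation mass** `∑_{σ ∈ S_n} coeff_{μ_σ} f` of `f`: the sum of the coefficients of `f`
on the `n!` permutation monomials `∏_i X_{(σ i, i)}`, i.e. the inner product, in coefficient space,
of `f` with the permanent `per_n` (all of whose coefficients are `1`, `coeff_permMonomial_perPoly`).
[folklore] -/
def permMass (n : ℕ) (f : MvPolynomial (Fin n × Fin n) R) : R :=
  ∑ σ : Equiv.Perm (Fin n), coeff (permMonomial σ) f

/-- Unfolding `permMass`. [folklore] -/
theorem permMass_def (f : MvPolynomial (Fin n × Fin n) R) :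
    permMass n f = ∑ σ : Equiv.Perm (Fin n), coeff (permMonomial σ) f := rfl

/-- `permMass n 0 = 0`. [folklore] -/
@[simp]
theorem permMass_zero : permMass n (0 : MvPolynomial (Fin n × Fin n) R) = 0 := by
  simp [permMass]

/-- `permMass` is additive. [folklore] -/
theorem permMass_add (f g : MvPolynomial (Fin n × Fin n) R) :
    permMass n (f + g) = permMass n f + permMass n g := by
  simp [permMass, Finset.sum_add_distrib]

/-- `permMass` commutes with finite sums. [folklore] -/
theorem permMass_sum {ι : Type*} (s : Finset ι) (f : ι → MvPolynomial (Fin n × Fin n) R) :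
    permMass n (∑ t ∈ s, f t) = ∑ t ∈ s, permMass n (f t) := by
  simp only [permMass, coeff_sum]
  exact Finset.sum_comm

/-- `permMass` is homogeneous: `permMass n (c • f) = c · permMass n f`. [folklore] -/
theorem permMass_smul (c : R) (f : MvPolynomial (Fin n × Fin n) R) :
    permMass n (c • f) = c * permMass n f := by
  simp [permMass, Finset.mul_sum]

/-- `permMass n (C c * f) = c · permMass n f`. [folklore] -/
theorem permMass_C_mul (c : R) (f : MvPolynomial (Fin n × Fin n) R) :
    permMass n (C c * f) = c * permMass n f := by
  rw [C_mul', permMass_smul]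

/-- `permMass` commutes with a change of scalars (e.g. `ℝ≥0 → ℝ`, `ℝ → ℂ`). [folklore] -/
theorem permMass_map {S : Type*} [CommSemiring S] (g : R →+* S)
    (f : MvPolynomial (Fin n × Fin n) R) : permMass n (map g f) = g (permMass n f) := by
  simp [permMass, coeff_map]

/-- **`permMass n per_n = n!`**: the permanent has coefficient `1` on each of its `n!` permutation
monomials. [folklore] -/
theorem permMass_perPoly (R : Type*) [CommSemiring R] :
    permMass n (perPoly (Fin n) R) = (n.factorial : R) := by
  simp only [permMass, coeff_permMonomial_perPoly, Finset.sum_const, Finset.card_univ,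
    Fintype.card_perm, Fintype.card_fin, nsmul_eq_mul, mul_one]

/-- The permutation mass of a column-set-multilinear polynomial is the sum of its coefficient
function over the permutations. [folklore] -/
theorem permMass_columnMultilinear (c : (Fin n → Fin n) → R) :
    permMass n (columnMultilinear c) = ∑ σ : Equiv.Perm (Fin n), c σ :=
  Finset.sum_congr rfl fun σ _ => coeff_permMonomial_columnMultilinear c σ

/-- **Permutation mass of a product of linear forms**:
`permMass n (∏_i ∑_j a_{ij} X_{(j,i)}) = ∑_σ ∏_i a_{i,σ i}`. [folklore] -/
theorem permMass_prod_linearForm (a : Fin n → Fin n → R) :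
    permMass n (∏ i : Fin n, ∑ j : Fin n, C (a i j) * X (j, i) : MvPolynomial (Fin n × Fin n) R) =
      ∑ σ : Equiv.Perm (Fin n), ∏ i, a i (σ i) := by
  rw [prod_linearForm_eq_columnMultilinear, permMass_columnMultilinear]

/-- … which is the permanent of the array `a` (Carlen–Lieb–Loss 2006, eq. (1.3):
`∫_{S_N} ∏_j f_j ∘ π_j dμ = perm(F)/N!`). [cite: CarlenLiebLoss2006, eq. (1.3)] -/
theorem permMass_prod_linearForm_eq_permanent (a : Fin n → Fin n → R) :
    permMass n (∏ i : Fin n, ∑ j : Fin n, C (a i j) * X (j, i) : MvPolynomial (Fin n × Fin n) R) =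
      (Matrix.of a).permanent := by
  rw [permMass_prod_linearForm, ← Matrix.permanent_transpose]
  rfl

end PermMass

/-! ### Layer-ordered set-multilinear branching programs -/

section ABP

variable {R : Type*} [CommSemiring R]

/-- `uᵀ · A₀(φ 0) · A₁(φ 1) ⋯ A_{n-1}(φ (n-1)) · v`: the coefficient, on the monomial
`∏_i X_{(φ i, i)}`, of the polynomial computed by the layer-ordered set-multilinear algebraic
branching program of width `w` whose edges from layer `i` to layer `i+1` labelled by the variable
`X_{(j, i)}` carry the matrix `A i j` (source vector `u`, sink vector `v`) — the iterated matrix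
product form of a branching program (Nisan 1991). [folklore] -/
def rowABPCoeff (n w : ℕ) (A : Fin n → Fin n → Matrix (Fin w) (Fin w) R) (u v : Fin w → R)
    (φ : Fin n → Fin n) : R :=
  u ⬝ᵥ ((List.ofFn fun i => A i (φ i)).prod *ᵥ v)

/-- Unfolding `rowABPCoeff`. [folklore] -/
theorem rowABPCoeff_def (w : ℕ) (A : Fin n → Fin n → Matrix (Fin w) (Fin w) R) (u v : Fin w → R)
    (φ : Fin n → Fin n) :
    rowABPCoeff n w A u v φ = u ⬝ᵥ ((List.ofFn fun i => A i (φ i)).prod *ᵥ v) := rfl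

/-- With no layers the program computes the constant `u ⬝ᵥ v`. [folklore] -/
theorem rowABPCoeff_zero_layers (w : ℕ) (A : Fin 0 → Fin 0 → Matrix (Fin w) (Fin w) R)
    (u v : Fin w → R) (φ : Fin 0 → Fin 0) : rowABPCoeff 0 w A u v φ = u ⬝ᵥ v := by
  simp [rowABPCoeff]

/-- The `(0,0)` entry of a product of `1 × 1` matrices is the product of the entries. [folklore] -/
theorem list_prod_matrix_fin_one_apply (L : List (Matrix (Fin 1) (Fin 1) R)) :
    L.prod 0 0 = (L.map fun M => M 0 0).prod := by
  induction L with
  | nil => simp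
  | cons M L ih =>
      rw [List.prod_cons, List.map_cons, List.prod_cons, Matrix.mul_apply, Fin.sum_univ_one, ih]

/-- **Width one**: a width-`1` program has coefficients `u₀ v₀ ∏_i A i (φ i)`, i.e. computes the
product of linear forms `u₀ v₀ ∏_i (∑_j (A i j)₀₀ X_{(j,i)})` (the Carlen–Lieb–Loss endpoint of the
branching-program scale). [folklore] -/
theorem rowABPCoeff_width_one (A : Fin n → Fin n → Matrix (Fin 1) (Fin 1) R) (u v : Fin 1 → R)
    (φ : Fin n → Fin n) : rowABPCoeff n 1 A u v φ = u 0 * v 0 * ∏ i, A i (φ i) 0 0 := by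
  simp only [rowABPCoeff, Matrix.mulVec, dotProduct, Fin.sum_univ_one]
  rw [list_prod_matrix_fin_one_apply, List.map_ofFn, List.prod_ofFn]
  simp only [Function.comp_apply]
  ring

/-- The polynomial `∑_φ (uᵀ ∏_i A i (φ i) v) · ∏_i X_{(φ i, i)}` computed by the layer-ordered
set-multilinear branching program with transition matrices `A`. [folklore] -/
def rowABPPoly (n w : ℕ) (A : Fin n → Fin n → Matrix (Fin w) (Fin w) R) (u v : Fin w → R) :
    MvPolynomial (Fin n × Fin n) R :=
  columnMultilinear (rowABPCoeff n w A u v)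

/-- `rowABPCoeff` is the coefficient of `rowABPPoly` on `∏_i X_{(φ i, i)}`. [folklore] -/
@[simp]
theorem coeff_selfMapMonomial_rowABPPoly (w : ℕ) (A : Fin n → Fin n → Matrix (Fin w) (Fin w) R)
    (u v : Fin w → R) (φ : Fin n → Fin n) :
    coeff (selfMapMonomial φ) (rowABPPoly n w A u v) = rowABPCoeff n w A u v φ :=
  coeff_selfMapMonomial_columnMultilinear _ φ

/-- `permMass` of a branching-program polynomial: `∑_σ uᵀ (∏_i A i (σ i)) v`. [folklore] -/
theorem permMass_rowABPPoly (w : ℕ) (A : Fin n → Fin n → Matrix (Fin w) (Fin w) R)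
    (u v : Fin w → R) :
    permMass n (rowABPPoly n w A u v) = ∑ σ : Equiv.Perm (Fin n), rowABPCoeff n w A u v σ :=
  permMass_columnMultilinear _

end ABP

/-! ### The coefficient norm and the squared cosine with the permanent -/

section Norm

variable {R : Type*} [CommSemiring R] [Norm R]

/-- The **squared `ℓ²` norm of the coefficient vector** of `f`: `∑_{m ∈ supp f} ‖coeff_m f‖²` (all
monomials of `f` count). [folklore] -/
def coeffNormSq (n : ℕ) (f : MvPolynomial (Fin n × Fin n) R) : ℝ :=
  f.support.sum (fun m => ‖coeff m f‖ ^ 2)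

/-- Unfolding `coeffNormSq`. [folklore] -/
theorem coeffNormSq_def (f : MvPolynomial (Fin n × Fin n) R) :
    coeffNormSq n f = f.support.sum (fun m => ‖coeff m f‖ ^ 2) := rfl

/-- The **squared cosine between `f` and the permanent** in coefficient space,
`‖permMass n f‖² / (n! · coeffNormSq n f)` (`n! = coeffNormSq n per_n`; real division, so the value
at `f = 0` is `0`). [folklore] -/
def permCorrSq (n : ℕ) (f : MvPolynomial (Fin n × Fin n) R) : ℝ :=
  ‖permMass n f‖ ^ 2 / ((n.factorial : ℝ) * coeffNormSq n f)

/-- Unfolding `permCorrSq`. [folklore] -/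
theorem permCorrSq_def (f : MvPolynomial (Fin n × Fin n) R) :
    permCorrSq n f = ‖permMass n f‖ ^ 2 / ((n.factorial : ℝ) * coeffNormSq n f) := rfl

/-- `0 ≤ coeffNormSq n f`. [folklore] -/
theorem coeffNormSq_nonneg (f : MvPolynomial (Fin n × Fin n) R) : 0 ≤ coeffNormSq n f :=
  Finset.sum_nonneg fun _ _ => sq_nonneg _

/-- `0 ≤ permCorrSq n f`. [folklore] -/
theorem permCorrSq_nonneg (f : MvPolynomial (Fin n × Fin n) R) : 0 ≤ permCorrSq n f :=
  div_nonneg (sq_nonneg _) (mul_nonneg (Nat.cast_nonneg _) (coeffNormSq_nonneg f))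

end Norm

section NormedCommRing

variable {R : Type*} [NormedCommRing R]

/-- `coeffNormSq n 0 = 0`. [folklore] -/
@[simp]
theorem coeffNormSq_zero : coeffNormSq n (0 : MvPolynomial (Fin n × Fin n) R) = 0 := by
  simp [coeffNormSq]

/-- Summing `‖coeff_m f‖²` over any finite set of monomials containing the support of `f` gives
`coeffNormSq n f`. [folklore] -/
theorem coeffNormSq_eq_sum_of_support_subset {f : MvPolynomial (Fin n × Fin n) R}
    {S : Finset ((Fin n × Fin n) →₀ ℕ)} (hS : f.support ⊆ S) :
    coeffNormSq n f = ∑ m ∈ S, ‖coeff m f‖ ^ 2 := by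
  unfold coeffNormSq
  refine Finset.sum_subset hS fun m _ hm => ?_
  have h0 : coeff m f = 0 := by simpa [mem_support_iff] using hm
  rw [h0, norm_zero, zero_pow two_ne_zero]

/-- `coeffNormSq n f = 0 ↔ f = 0`. [folklore] -/
theorem coeffNormSq_eq_zero_iff {f : MvPolynomial (Fin n × Fin n) R} :
    coeffNormSq n f = 0 ↔ f = 0 := by
  constructor
  · intro h
    rw [coeffNormSq, Finset.sum_eq_zero_iff_of_nonneg fun _ _ => sq_nonneg _] at h
    ext m
    rw [coeff_zero]
    by_contra hm
    have := h m (mem_support_iff.2 hm)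
    rw [sq_eq_zero_iff, norm_eq_zero] at this
    exact hm this
  · rintro rfl
    exact coeffNormSq_zero

/-- `0 < coeffNormSq n f ↔ f ≠ 0`. [folklore] -/
theorem coeffNormSq_pos_iff {f : MvPolynomial (Fin n × Fin n) R} :
    0 < coeffNormSq n f ↔ f ≠ 0 := by
  rw [(coeffNormSq_nonneg f).lt_iff_ne', ne_eq, coeffNormSq_eq_zero_iff]

/-- The `n!` permutation monomials carry at most the whole coefficient mass:
`∑_σ ‖coeff_{μ_σ} f‖² ≤ coeffNormSq n f`. [folklore] -/
theorem sum_norm_sq_coeff_permMonomial_le (f : MvPolynomial (Fin n × Fin n) R) :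
    ∑ σ : Equiv.Perm (Fin n), ‖coeff (permMonomial σ) f‖ ^ 2 ≤ coeffNormSq n f := by
  calc ∑ σ : Equiv.Perm (Fin n), ‖coeff (permMonomial σ) f‖ ^ 2
      = ∑ m ∈ (Finset.univ : Finset (Equiv.Perm (Fin n))).image permMonomial, ‖coeff m f‖ ^ 2 := by
        rw [Finset.sum_image fun σ _ τ _ h => permMonomial_injective h]
    _ ≤ ∑ m ∈ (Finset.univ : Finset (Equiv.Perm (Fin n))).image permMonomial ∪ f.support,
          ‖coeff m f‖ ^ 2 :=
        Finset.sum_le_sum_of_subset_of_nonneg Finset.subset_union_left fun _ _ _ => sq_nonneg _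
    _ = coeffNormSq n f :=
        (coeffNormSq_eq_sum_of_support_subset Finset.subset_union_right).symm

/-- **Cauchy–Schwarz over the permutation monomials**: `‖permMass n f‖² ≤ n! · coeffNormSq n f`.
[folklore] -/
theorem norm_permMass_sq_le (f : MvPolynomial (Fin n × Fin n) R) :
    ‖permMass n f‖ ^ 2 ≤ (n.factorial : ℝ) * coeffNormSq n f := by
  have h1 : ‖permMass n f‖ ≤ ∑ σ : Equiv.Perm (Fin n), ‖coeff (permMonomial σ) f‖ :=
    norm_sum_le _ _
  calc ‖permMass n f‖ ^ 2
      ≤ (∑ σ : Equiv.Perm (Fin n), ‖coeff (permMonomial σ) f‖) ^ 2 := by gcongr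
    _ ≤ (Finset.univ : Finset (Equiv.Perm (Fin n))).card *
          ∑ σ : Equiv.Perm (Fin n), ‖coeff (permMonomial σ) f‖ ^ 2 :=
        sq_sum_le_card_mul_sum_sq
    _ = (n.factorial : ℝ) * ∑ σ : Equiv.Perm (Fin n), ‖coeff (permMonomial σ) f‖ ^ 2 := by
        rw [Finset.card_univ, Fintype.card_perm, Fintype.card_fin]
    _ ≤ (n.factorial : ℝ) * coeffNormSq n f := by
        gcongr
        exact sum_norm_sq_coeff_permMonomial_le f

/-- **`permCorrSq n f ≤ 1`.** [folklore] -/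
theorem permCorrSq_le_one (f : MvPolynomial (Fin n × Fin n) R) : permCorrSq n f ≤ 1 :=
  div_le_one_of_le₀ (norm_permMass_sq_le f) (mul_nonneg (Nat.cast_nonneg _) (coeffNormSq_nonneg f))

/-- `permCorrSq n 0 = 0` (junk value of the real division). [folklore] -/
@[simp]
theorem permCorrSq_zero : permCorrSq n (0 : MvPolynomial (Fin n × Fin n) R) = 0 := by
  simp [permCorrSq]

/-- `permCorrSq n f · (n! · coeffNormSq n f) = ‖permMass n f‖²` (both sides vanish at `f = 0`).
[folklore] -/
theorem permCorrSq_mul_eq (f : MvPolynomial (Fin n × Fin n) R) :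
    permCorrSq n f * ((n.factorial : ℝ) * coeffNormSq n f) = ‖permMass n f‖ ^ 2 := by
  by_cases hf : f = 0
  · subst hf
    simp
  · exact div_mul_cancel₀ _
      (mul_ne_zero (Nat.cast_ne_zero.2 (Nat.factorial_ne_zero n)) (coeffNormSq_pos_iff.2 hf).ne')

/-- A bound `permCorrSq n f ≤ t` (`0 ≤ t`) in the division-free form in which route items are
written: `‖permMass n f‖² ≤ t · (n! · coeffNormSq n f)`. [folklore] -/
theorem permCorrSq_le_iff {f : MvPolynomial (Fin n × Fin n) R} {t : ℝ} (ht : 0 ≤ t) :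
    permCorrSq n f ≤ t ↔ ‖permMass n f‖ ^ 2 ≤ t * ((n.factorial : ℝ) * coeffNormSq n f) := by
  by_cases hf : f = 0
  · subst hf
    simp [ht]
  · exact div_le_iff₀ (mul_pos (Nat.cast_pos.2 (Nat.factorial_pos n)) (coeffNormSq_pos_iff.2 hf))

/-- Dually, `t ≤ permCorrSq n f ↔ t · (n! · coeffNormSq n f) ≤ ‖permMass n f‖²` for `f ≠ 0`.
[folklore] -/
theorem le_permCorrSq_iff {f : MvPolynomial (Fin n × Fin n) R} (hf : f ≠ 0) (t : ℝ) :
    t ≤ permCorrSq n f ↔ t * ((n.factorial : ℝ) * coeffNormSq n f) ≤ ‖permMass n f‖ ^ 2 :=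
  le_div_iff₀ (mul_pos (Nat.cast_pos.2 (Nat.factorial_pos n)) (coeffNormSq_pos_iff.2 hf))

/-- `coeffNormSq` of a column-set-multilinear polynomial is the squared `ℓ²` norm of its
coefficient function. [folklore] -/
theorem coeffNormSq_columnMultilinear (c : (Fin n → Fin n) → R) :
    coeffNormSq n (columnMultilinear c) = ∑ φ : Fin n → Fin n, ‖c φ‖ ^ 2 := by
  rw [coeffNormSq_eq_sum_of_support_subset (support_columnMultilinear_subset c),
    Finset.sum_image fun φ _ ψ _ h => selfMapMonomial_injective h]
  simp only [coeff_selfMapMonomial_columnMultilinear]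

/-- `coeffNormSq` of a branching-program polynomial: `∑_φ ‖uᵀ (∏_i A i (φ i)) v‖²`. [folklore] -/
theorem coeffNormSq_rowABPPoly (w : ℕ) (A : Fin n → Fin n → Matrix (Fin w) (Fin w) R)
    (u v : Fin w → R) :
    coeffNormSq n (rowABPPoly n w A u v) = ∑ φ : Fin n → Fin n, ‖rowABPCoeff n w A u v φ‖ ^ 2 :=
  coeffNormSq_columnMultilinear _

/-- **`coeffNormSq n per_n = n!`**: `n!` monomials with coefficient `1`. [folklore] -/
theorem coeffNormSq_perPoly [NormOneClass R] :
    coeffNormSq n (perPoly (Fin n) R) = n.factorial := by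
  have hsub : (perPoly (Fin n) R).support ⊆
      (Finset.univ : Finset (Equiv.Perm (Fin n))).image permMonomial := by
    intro m hm
    obtain ⟨σ, rfl⟩ := exists_permMonomial_eq_of_coeff_perPoly_ne_zero R (mem_support_iff.1 hm)
    exact Finset.mem_image_of_mem _ (Finset.mem_univ σ)
  rw [coeffNormSq_eq_sum_of_support_subset hsub,
    Finset.sum_image fun σ _ τ _ h => permMonomial_injective h]
  simp [coeff_permMonomial_perPoly, Fintype.card_perm]

end NormedCommRing

section NormedField

variable {𝕜 : Type*} [NormedField 𝕜]

/-- `coeffNormSq n (c • f) = ‖c‖² · coeffNormSq n f`. [folklore] -/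
theorem coeffNormSq_smul (c : 𝕜) (f : MvPolynomial (Fin n × Fin n) 𝕜) :
    coeffNormSq n (c • f) = ‖c‖ ^ 2 * coeffNormSq n f := by
  by_cases hc : c = 0
  · subst hc
    simp
  · unfold coeffNormSq
    rw [support_smul_eq hc, Finset.mul_sum]
    refine Finset.sum_congr rfl fun m _ => ?_
    rw [coeff_smul, smul_eq_mul, norm_mul, mul_pow]

/-- **Scale invariance**: `permCorrSq n (c • f) = permCorrSq n f` for `c ≠ 0`. [folklore] -/
theorem permCorrSq_smul {c : 𝕜} (hc : c ≠ 0) (f : MvPolynomial (Fin n × Fin n) 𝕜) :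
    permCorrSq n (c • f) = permCorrSq n f := by
  unfold permCorrSq
  rw [permMass_smul, coeffNormSq_smul, norm_mul, mul_pow, mul_left_comm (n.factorial : ℝ),
    mul_div_mul_left _ _ (pow_ne_zero 2 (norm_ne_zero_iff.2 hc))]

/-- `permCorrSq n (C c * f) = permCorrSq n f` for `c ≠ 0`. [folklore] -/
theorem permCorrSq_C_mul {c : 𝕜} (hc : c ≠ 0) (f : MvPolynomial (Fin n × Fin n) 𝕜) :
    permCorrSq n (C c * f) = permCorrSq n f := by
  rw [C_mul', permCorrSq_smul hc]

/-- **Coefficient norm of a product of linear forms**: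
`coeffNormSq n (∏_i ∑_j a_{ij} X_{(j,i)}) = ∏_i ∑_j ‖a_{ij}‖²`. [folklore] -/
theorem coeffNormSq_prod_linearForm (a : Fin n → Fin n → 𝕜) :
    coeffNormSq n (∏ i : Fin n, ∑ j : Fin n, C (a i j) * X (j, i) : MvPolynomial (Fin n × Fin n) 𝕜) =
      ∏ i, ∑ j, ‖a i j‖ ^ 2 := by
  rw [prod_linearForm_eq_columnMultilinear, coeffNormSq_columnMultilinear, Fintype.prod_sum]
  refine Finset.sum_congr rfl fun φ _ => ?_
  rw [norm_prod, ← Finset.prod_pow]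

/-- Hence the squared cosine of a product of linear forms with the permanent is
`‖∑_σ ∏_i a_{i,σ i}‖² / (n! · ∏_i ∑_j ‖a_{ij}‖²)` — the quantity that Carlen–Lieb–Loss's Theorem 1.1
bounds by `n!/nⁿ`. [folklore] -/
theorem permCorrSq_prod_linearForm (a : Fin n → Fin n → 𝕜) :
    permCorrSq n (∏ i : Fin n, ∑ j : Fin n, C (a i j) * X (j, i) : MvPolynomial (Fin n × Fin n) 𝕜) =
      ‖∑ σ : Equiv.Perm (Fin n), ∏ i, a i (σ i)‖ ^ 2 /
        ((n.factorial : ℝ) * ∏ i, ∑ j, ‖a i j‖ ^ 2) := by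
  rw [permCorrSq, permMass_prod_linearForm, coeffNormSq_prod_linearForm]

end NormedField

section RCLike

variable {𝕜 : Type*} [RCLike 𝕜]

/-- **The permanent has squared cosine `1` with itself**: `permCorrSq n per_n = 1` (over `ℝ` or
`ℂ`). [folklore] -/
theorem permCorrSq_perPoly : permCorrSq n (perPoly (Fin n) 𝕜) = 1 := by
  rw [permCorrSq, permMass_perPoly, coeffNormSq_perPoly, RCLike.norm_natCast]
  have h : (n.factorial : ℝ) ≠ 0 := Nat.cast_ne_zero.2 (Nat.factorial_ne_zero n)
  rw [sq, div_self (mul_ne_zero h h)]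

end RCLike

end Literature.Computability.AlgebraicComplexity

end
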